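import Mathlib.Analysis.SpecialFunctions.Complex.LogDeriv
import Mathlib.MeasureTheory.Integral.DominatedConvergence
import Literature.Probability.LatticeModels.ClusterExpansion
import HarnessLib

/-!
# Activity paths in abstract polymer gases: derivative of `Z`, continuity of `log Z` and `Φ^T`, the log-increment identity

Support layer for the proof of the Kotecký–Preiss estimate [KP86, (4)]
(`Literature.Probability.LatticeModels.koteckyPreiss_truncatedWeight_bound`, discharged in the
sibling `ClusterExpansionKPBound.lean`), in the vocabulary of `PolymerGas` / `ClusterExpansion`
(`polymerPartitionFunction`, `polymerRayDeriv`, `polymerLogZ`, `truncatedWeight`, `IsKPVolume`).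
Kotecký–Preiss prove (4) in a fixed finite volume `L` by a continuity ("bootstrap") argument in
the activities ([KP86, §3]): one moves the polymer functional along paths `t ↦ Φ_t` (formula (12):
the activities of the polymers incompatible with a fixed `γ` are scaled by `t`), differentiates
`log 𝒵(B; Φ_t)` (formula (13)) and uses continuity and compactness in the space of functionals.
This file supplies exactly these analytic inputs; everything is PROVED, no named facts.

## Main results (namespace `Literature.Probability.LatticeModels`)

* `sum_prod_erase_eq_polymerPartitionFunction_filter`: the "marked" form of the one-polymer
  recursion, `Σ_{X ⊆ B compatible, δ ∈ X} Π_{X ∖ δ} v = Z({γ' ∈ B : γ' compatible with δ})`, i.e.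
  `∂Z(B)/∂v(δ)`.
* `hasDerivAt_polymerPartitionFunction_path`: **chain rule along an activity path** `t ↦ v_t`:
  `d/dt Z(B; v_t) = Σ_{δ ∈ B} v̇_t(δ) · Z({γ' ∈ B : γ' ∼ δ}; v_t)` ([KP86, (13), first line]).
* `scaledActivity w c = (δ ↦ c(δ) w(δ))` (real multipliers `c`, the coordinates used for the
  continuity/compactness argument of [KP86, §3]) and `scaleAt inc c γ t` (multiply `c` by `t` on
  the polymers incompatible with `γ`: the path `Φ_t` of [KP86, (12)]), with
  `hasDerivAt_polymerPartitionFunction_scaleAt`.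
* `continuous_polymerPartitionFunction_scaled`, `continuous_polymerRayDeriv_scaled`,
  `continuousOn_polymerLogZ_scaled`, `continuousOn_truncatedWeight_scaled`: `Z`, `Z'`, the
  Kotecký–Preiss logarithm and `Φ^T` are continuous in the multipliers `c` on any set where the
  partition functions along the rays `u • v`, `u ∈ [0,1]`, do not vanish (the integrand of
  `polymerLogZ` is clamped to `[0,1]` and `intervalIntegral.continuous_parametric_intervalIntegral_of_continuous'`
  applies).
* `integral_div_eq_sub_of_exp_eq`: **the log-increment identity** — if `ψ` is continuous on
  `[a,b]`, `exp ∘ ψ = ζ` there, and `ζ` is `C¹` and zero-free, then `∫ₐᵇ ζ'/ζ = ψ(b) - ψ(a)`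
  (locally `ψ` is a holomorphic branch of `log ζ` plus a constant, `Complex.hasDerivAt_log`, and
  `exp z = 1, ‖z‖ < 2π ⇒ z = 0`). This turns `Φ^T(C; Φ₁) - Φ^T(C; Φ₀)` into the integral of (13).
* `truncatedWeight_eq_zero_of_forall_inc_eq_zero` ([KP86, (11)]): if the activities of all
  polymers of `C` incompatible with `γ` vanish and `C ι γ`, then `Φ^T(C) = 0`.

## References

* [KP86] R. Kotecký, D. Preiss, *Cluster expansion for abstract polymer models*, Comm. Math.
  Phys. 103 (1986) 491–498, §3 (proof of the Theorem, formulas (9)–(13)). [KoteckyPreiss1986]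
* S. Friedli, Y. Velenik, *Statistical Mechanics of Lattice Systems* (2017), §5.4. [FriedliVelenik2017]
-/

noncomputable section

open Finset Filter Topology Set MeasureTheory intervalIntegral
open scoped BigOperators

namespace Literature.Probability.LatticeModels

variable {P : Type*} [DecidableEq P] {inc : P → P → Prop} [DecidableRel inc]

/-! ### The marked one-polymer recursion and the chain rule along activity paths -/

/-- With a reflexive symmetric incompatibility, the polymers of `B ∖ δ` compatible with `δ` are
the polymers of `B` compatible with `δ`. [folklore] -/
theorem erase_filter_not_inc_eq [Std.Refl inc] [Std.Symm inc] (B : Finset P) (δ : P) :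
    (B.erase δ).filter (fun γ' => ¬ inc δ γ') = B.filter fun γ' => ¬ inc γ' δ := by
  ext γ'
  simp only [Finset.mem_filter, Finset.mem_erase]
  constructor
  · rintro ⟨⟨-, h1⟩, h2⟩
    exact ⟨h1, fun h => h2 (Std.Symm.symm _ _ h)⟩
  · rintro ⟨h1, h2⟩
    refine ⟨⟨?_, h1⟩, fun h => h2 (Std.Symm.symm _ _ h)⟩
    rintro rfl
    exact h2 (Std.Refl.refl γ')

/-- The polymers of `B` incompatible with `δ` form the complement, in `B`, of those compatible
with `δ`. [folklore] -/
theorem sdiff_filter_inc_eq (B : Finset P) (δ : P) :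
    B \ B.filter (fun γ' => inc γ' δ) = B.filter fun γ' => ¬ inc γ' δ := by
  ext γ'
  simp only [Finset.mem_sdiff, Finset.mem_filter]
  tauto

/-- **Marked one-polymer recursion** (`∂Z(B)/∂v(δ)`): the sum over the compatible subfamilies
of `B` containing `δ` of the products of the activities of their OTHER members is the partition
function of the polymers of `B` compatible with `δ` (bijection `X ↦ X ∖ δ`; cf. the proof of
`polymerPartitionFunction_insert`). [cite: KoteckyPreiss1986, §3 (13) (𝒵(B∖[γ']; Φ) as the coefficient of Φ(γ'))] -/
theorem sum_prod_erase_eq_polymerPartitionFunction_filter [Std.Refl inc] [Std.Symm inc]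
    (v : P → ℂ) {B : Finset P} {δ : P} (hδ : δ ∈ B) :
    ∑ X ∈ (B.powerset.filter fun X => IsCompatible inc X) with δ ∈ X, ∏ γ ∈ X.erase δ, v γ =
      polymerPartitionFunction inc v (B.filter fun γ' => ¬ inc γ' δ) := by
  rw [polymerPartitionFunction_eq_sum_filter]
  symm
  refine Finset.sum_nbij' (fun Y => insert δ Y) (fun X => X.erase δ) ?_ ?_ ?_ ?_ ?_
  · intro Y hY
    simp only [Finset.mem_filter, Finset.mem_powerset] at hY ⊢
    obtain ⟨hYB, hYc⟩ := hY
    have hδY : δ ∉ Y := fun h => (Finset.mem_filter.1 (hYB h)).2 (Std.Refl.refl δ)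
    refine ⟨⟨Finset.insert_subset hδ (hYB.trans (Finset.filter_subset _ _)), ?_⟩,
      Finset.mem_insert_self δ Y⟩
    rw [isCompatible_insert inc_symm_of_symm hδY]
    exact ⟨hYc, fun γ' hγ' h => (Finset.mem_filter.1 (hYB hγ')).2 (Std.Symm.symm _ _ h)⟩
  · intro X hX
    simp only [Finset.mem_filter, Finset.mem_powerset] at hX ⊢
    obtain ⟨⟨hXB, hXc⟩, hδX⟩ := hX
    refine ⟨fun γ' hγ' => ?_, hXc.mono (Finset.erase_subset δ X)⟩
    obtain ⟨hne, hγ'X⟩ := Finset.mem_erase.1 hγ'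
    exact Finset.mem_filter.2 ⟨hXB hγ'X, (isCompatible_iff.1 hXc) γ' hγ'X δ hδX hne⟩
  · intro Y hY
    simp only [Finset.mem_filter, Finset.mem_powerset] at hY
    have hδY : δ ∉ Y := fun h => (Finset.mem_filter.1 (hY.1 h)).2 (Std.Refl.refl δ)
    exact Finset.erase_insert hδY
  · intro X hX
    simp only [Finset.mem_filter, Finset.mem_powerset] at hX
    exact Finset.insert_erase hX.2
  · intro Y hY
    simp only [Finset.mem_filter, Finset.mem_powerset] at hY
    have hδY : δ ∉ Y := fun h => (Finset.mem_filter.1 (hY.1 h)).2 (Std.Refl.refl δ)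
    rw [Finset.erase_insert hδY]

/-- **Chain rule along an activity path** ([KP86, (13)]): if every activity `t ↦ v_t(δ)`,
`δ ∈ B`, has derivative `v̇(δ)` at `t`, then
`d/dt Z(B; v_t) = Σ_{δ ∈ B} v̇(δ) · Z({γ' ∈ B : γ' compatible with δ}; v_t)` (the partition
function is multi-affine in the activities, with `∂Z(B)/∂v(δ) = Z(B ∖ [δ])`). [cite: KoteckyPreiss1986, §3 (13)] -/
theorem hasDerivAt_polymerPartitionFunction_path [Std.Refl inc] [Std.Symm inc]
    {v : ℝ → P → ℂ} {v' : P → ℂ} {t : ℝ} (B : Finset P)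
    (hv : ∀ δ ∈ B, HasDerivAt (fun s => v s δ) (v' δ) t) :
    HasDerivAt (fun s => polymerPartitionFunction inc (v s) B)
      (∑ δ ∈ B, v' δ * polymerPartitionFunction inc (v t) (B.filter fun γ' => ¬ inc γ' δ)) t := by
  have hfun : (fun s => polymerPartitionFunction inc (v s) B) =
      fun s => ∑ X ∈ B.powerset with IsCompatible inc X, ∏ γ ∈ X, v s γ := by
    funext s
    exact polymerPartitionFunction_eq_sum_filter (v s) B
  rw [hfun]
  -- derivative of each product
  have hX : ∀ X ∈ B.powerset.filter (fun X => IsCompatible inc X),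
      HasDerivAt (fun s => ∏ γ ∈ X, v s γ) (∑ δ ∈ X, (∏ γ ∈ X.erase δ, v t γ) * v' δ) t := by
    intro X hX
    have hXB : X ⊆ B := Finset.mem_powerset.1 (Finset.mem_filter.1 hX).1
    have h := HasDerivAt.fun_finsetProd (u := X) (f := fun γ s => v s γ) (f' := v') (x := t)
      fun γ hγ => hv γ (hXB hγ)
    simpa [smul_eq_mul] using h
  refine (HasDerivAt.fun_sum hX).congr_deriv ?_
  -- exchange the sums and use the marked recursion
  have hinner : ∀ X ∈ B.powerset.filter (fun X => IsCompatible inc X),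
      ∑ δ ∈ X, (∏ γ ∈ X.erase δ, v t γ) * v' δ =
        ∑ δ ∈ B, if δ ∈ X then (∏ γ ∈ X.erase δ, v t γ) * v' δ else 0 := by
    intro X hX
    have hXB : X ⊆ B := Finset.mem_powerset.1 (Finset.mem_filter.1 hX).1
    rw [← Finset.sum_filter, Finset.filter_mem_eq_inter, Finset.inter_eq_right.2 hXB]
  rw [Finset.sum_congr rfl hinner, Finset.sum_comm]
  refine Finset.sum_congr rfl fun δ hδ => ?_
  rw [← Finset.sum_filter, ← Finset.sum_mul,
    sum_prod_erase_eq_polymerPartitionFunction_filter (v t) hδ, mul_comm]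

/-! ### Real multipliers of the activities and the partial scaling path -/

/-- The activities `δ ↦ c(δ) w(δ)` obtained from `w` by real multipliers `c` (the coordinates in
which [KP86, §3] move the polymer functional: `Φ_t`, `tΦ`). [cite: KoteckyPreiss1986, §3 (the functionals Φ_t and tΦ)] -/
def scaledActivity (w : P → ℂ) (c : P → ℝ) : P → ℂ := fun δ => (c δ : ℂ) * w δ

omit [DecidableEq P] in
/-- Unfolding of `scaledActivity`. [folklore] -/
@[simp] theorem scaledActivity_apply (w : P → ℂ) (c : P → ℝ) (δ : P) :
    scaledActivity w c δ = (c δ : ℂ) * w δ := rfl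

omit [DecidableEq P] in
/-- With all multipliers equal to `1` the activities are unchanged. [folklore] -/
theorem scaledActivity_one (w : P → ℂ) : scaledActivity w (fun _ => 1) = w := by
  funext δ; simp [scaledActivity]

omit [DecidableEq P] in
/-- The norm of a scaled activity with a multiplier in `[0, 1]` is at most the original one.
[folklore] -/
theorem norm_scaledActivity_le {w : P → ℂ} {c : P → ℝ} {δ : P} (h0 : 0 ≤ c δ) (h1 : c δ ≤ 1) :
    ‖scaledActivity w c δ‖ ≤ ‖w δ‖ := by
  rw [scaledActivity_apply, norm_mul, Complex.norm_real, Real.norm_eq_abs, abs_of_nonneg h0]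
  exact mul_le_of_le_one_left (norm_nonneg _) h1

omit [DecidableEq P] in
/-- The norm of a scaled activity with a nonnegative multiplier. [folklore] -/
theorem norm_scaledActivity {w : P → ℂ} {c : P → ℝ} {δ : P} (h0 : 0 ≤ c δ) :
    ‖scaledActivity w c δ‖ = c δ * ‖w δ‖ := by
  rw [scaledActivity_apply, norm_mul, Complex.norm_real, Real.norm_eq_abs, abs_of_nonneg h0]

/-- The partial scaling of the multipliers: multiply `c` by `t` on the polymers incompatible
with `γ` (the path `Φ_t` of [KP86, (12)]). [cite: KoteckyPreiss1986, §3 (12) (definition of Φ_t)] -/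
def scaleAt (inc : P → P → Prop) [DecidableRel inc] (c : P → ℝ) (γ : P) (t : ℝ) : P → ℝ :=
  fun δ => if inc δ γ then t * c δ else c δ

omit [DecidableEq P] in
/-- Unfolding of `scaleAt`. [folklore] -/
theorem scaleAt_apply (c : P → ℝ) (γ : P) (t : ℝ) (δ : P) :
    scaleAt inc c γ t δ = if inc δ γ then t * c δ else c δ := rfl

omit [DecidableEq P] in
/-- At `t = 1` the partial scaling is the identity. [folklore] -/
@[simp] theorem scaleAt_one (c : P → ℝ) (γ : P) : scaleAt inc c γ 1 = c := by
  funext δ; simp [scaleAt]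

omit [DecidableEq P] in
/-- At `t = 0` the partially scaled activities vanish on the polymers incompatible with `γ`.
[folklore] -/
theorem scaledActivity_scaleAt_zero_of_inc (w : P → ℂ) (c : P → ℝ) {γ δ : P} (h : inc δ γ) :
    scaledActivity w (scaleAt inc c γ 0) δ = 0 := by
  simp [scaledActivity, scaleAt, h]

omit [DecidableEq P] in
/-- The partial scaling keeps multipliers in `[0, s]` inside `[0, s]` for `t ∈ [0, 1]`.
[folklore] -/
theorem scaleAt_mem_Icc {c : P → ℝ} {s : ℝ} (hc : ∀ δ, c δ ∈ Set.Icc 0 s) (γ : P) {t : ℝ}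
    (ht : t ∈ Set.Icc (0 : ℝ) 1) (δ : P) : scaleAt inc c γ t δ ∈ Set.Icc 0 s := by
  rw [scaleAt_apply]
  split_ifs
  · exact ⟨mul_nonneg ht.1 (hc δ).1, (mul_le_of_le_one_left (hc δ).1 ht.2).trans (hc δ).2⟩
  · exact hc δ

omit [DecidableEq P] in
/-- Each coordinate of the partial scaling path is affine in `t`, with derivative `c(δ) w(δ)`
on the polymers incompatible with `γ` and `0` elsewhere. [folklore] -/
theorem hasDerivAt_scaledActivity_scaleAt (w : P → ℂ) (c : P → ℝ) (γ : P) (t : ℝ) (δ : P) :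
    HasDerivAt (fun s : ℝ => scaledActivity w (scaleAt inc c γ s) δ)
      (if inc δ γ then scaledActivity w c δ else 0) t := by
  by_cases h : inc δ γ
  · simp only [scaledActivity_apply, scaleAt_apply, h, if_true, Complex.ofReal_mul]
    have h1 : HasDerivAt (fun s : ℝ => (s : ℂ) * ((c δ : ℂ) * w δ)) ((c δ : ℂ) * w δ) t := by
      simpa using (hasDerivAt_id (t : ℂ)).comp_ofReal.mul_const ((c δ : ℂ) * w δ)
    exact h1.congr_of_eventuallyEq (Eventually.of_forall fun s => by simp only; ring)
  · simp only [scaledActivity_apply, scaleAt_apply, h, if_false]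
    exact hasDerivAt_const t _

/-- **Derivative of the partition function along the partial scaling path** ([KP86, (13)]):
`d/dt Z(B; Φ_t) = Σ_{δ ∈ B, δ ι γ} Φ(δ) Z({γ' ∈ B : γ' ∼ δ}; Φ_t)`. [cite: KoteckyPreiss1986, §3 (13)] -/
theorem hasDerivAt_polymerPartitionFunction_scaleAt [Std.Refl inc] [Std.Symm inc] (w : P → ℂ)
    (c : P → ℝ) (γ : P) (B : Finset P) (t : ℝ) :
    HasDerivAt (fun s : ℝ => polymerPartitionFunction inc (scaledActivity w (scaleAt inc c γ s)) B)
      (∑ δ ∈ B with inc δ γ, scaledActivity w c δ *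
        polymerPartitionFunction inc (scaledActivity w (scaleAt inc c γ t))
          (B.filter fun γ' => ¬ inc γ' δ)) t := by
  have h := hasDerivAt_polymerPartitionFunction_path (inc := inc)
    (v := fun s => scaledActivity w (scaleAt inc c γ s))
    (v' := fun δ => if inc δ γ then scaledActivity w c δ else 0) (t := t) B
    fun δ _ => hasDerivAt_scaledActivity_scaleAt w c γ t δ
  refine h.congr_deriv ?_
  rw [Finset.sum_filter]
  refine Finset.sum_congr rfl fun δ _ => ?_
  split_ifs <;> simp

/-! ### Continuity in the multipliers -/

section Continuity

variable (inc)

/-- The partition function along the ray `u • (c·w)` is jointly continuous in the multipliers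
`c` and the ray parameter `u` (a polynomial in finitely many coordinates). [folklore] -/
theorem continuous_polymerPartitionFunction_scaled (w : P → ℂ) (B : Finset P) :
    Continuous fun p : (P → ℝ) × ℝ =>
      polymerPartitionFunction inc (fun δ => (p.2 : ℂ) * scaledActivity w p.1 δ) B := by
  have hfun : (fun p : (P → ℝ) × ℝ =>
      polymerPartitionFunction inc (fun δ => (p.2 : ℂ) * scaledActivity w p.1 δ) B) =
      fun p => ∑ X ∈ B.powerset with IsCompatible inc X,
        ∏ γ ∈ X, (p.2 : ℂ) * ((p.1 γ : ℂ) * w γ) := by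
    funext p
    rw [polymerPartitionFunction_eq_sum_filter]
    rfl
  rw [hfun]
  refine continuous_finsetSum _ fun X _ => continuous_finsetProd _ fun γ _ => ?_
  fun_prop

/-- The ray derivative `Z'(u)` of the scaled activities is jointly continuous in `(c, u)`.
[folklore] -/
theorem continuous_polymerRayDeriv_scaled (w : P → ℂ) (B : Finset P) :
    Continuous fun p : (P → ℝ) × ℝ => polymerRayDeriv inc (scaledActivity w p.1) B p.2 := by
  unfold polymerRayDeriv
  refine continuous_finsetSum _ fun X _ => ?_
  refine (continuous_const.mul ?_).mul (continuous_finsetProd _ fun γ _ => ?_)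
  · fun_prop
  · simp only [scaledActivity_apply]
    fun_prop

/-- The partition function is continuous in the multipliers. [folklore] -/
theorem continuous_polymerPartitionFunction_scaledActivity (w : P → ℂ) (B : Finset P) :
    Continuous fun c : P → ℝ => polymerPartitionFunction inc (scaledActivity w c) B := by
  have hfun : (fun c : P → ℝ => polymerPartitionFunction inc (scaledActivity w c) B) =
      fun c => ∑ X ∈ B.powerset with IsCompatible inc X, ∏ γ ∈ X, ((c γ : ℂ) * w γ) := by
    funext c
    rw [polymerPartitionFunction_eq_sum_filter]
    rfl
  rw [hfun]
  refine continuous_finsetSum _ fun X _ => continuous_finsetProd _ fun γ _ => ?_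
  fun_prop

variable {inc}

omit [DecidableEq P] in
/-- The partial scaling path is continuous into the product space of multipliers. [folklore] -/
theorem continuous_scaleAt (c : P → ℝ) (γ : P) : Continuous fun t : ℝ => scaleAt inc c γ t := by
  refine continuous_pi fun δ => ?_
  simp only [scaleAt_apply]
  split_ifs <;> fun_prop

/-- Clamping the ray parameter to `[0, 1]` does not change the integrand of the
Kotecký–Preiss logarithm on `[0, 1]`. [folklore] -/
theorem polymerLogZ_eq_integral_clamp (v : P → ℂ) (B : Finset P) :
    polymerLogZ inc v B = ∫ u in (0 : ℝ)..1,
      polymerRayDeriv inc v B (max 0 (min 1 u)) /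
        polymerPartitionFunction inc (fun γ => ((max 0 (min 1 u) : ℝ) : ℂ) * v γ) B := by
  unfold polymerLogZ
  refine intervalIntegral.integral_congr fun u hu => ?_
  rw [Set.uIcc_of_le zero_le_one] at hu
  have h : max 0 (min 1 u) = u := by
    rw [min_eq_right hu.2, max_eq_right hu.1]
  simp only [h]

/-- **Continuity of the Kotecký–Preiss logarithm in the multipliers**: on a set `S` of
multipliers for which the partition functions of `B` along the rays `u • (c·w)`, `u ∈ [0,1]`,
do not vanish, `c ↦ log Z(B; c·w)` is continuous (the clamped integrand is jointly continuous,
`intervalIntegral.continuous_parametric_intervalIntegral_of_continuous'`). This is the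
continuity of `log 𝒵(B; Φ)` on the zero-free region used in [KP86, §3]. [cite: KoteckyPreiss1986, §3 (continuity of 𝒵(B; Φ_t) in t, after (9))] -/
theorem continuousOn_polymerLogZ_scaled (w : P → ℂ) (B : Finset P) {S : Set (P → ℝ)}
    (hS : ∀ c ∈ S, ∀ u ∈ Set.Icc (0 : ℝ) 1,
      polymerPartitionFunction inc (fun δ => (u : ℂ) * scaledActivity w c δ) B ≠ 0) :
    ContinuousOn (fun c => polymerLogZ inc (scaledActivity w c) B) S := by
  have hclamp : Continuous fun u : ℝ => max 0 (min 1 u) := by fun_prop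
  have hmem : ∀ u : ℝ, max 0 (min 1 u) ∈ Set.Icc (0 : ℝ) 1 := fun u =>
    ⟨le_max_left _ _, max_le zero_le_one (min_le_left _ _)⟩
  have hg : Continuous fun q : S × ℝ => ((q.1 : P → ℝ), max 0 (min 1 q.2)) :=
    (continuous_subtype_val.comp continuous_fst).prodMk (hclamp.comp continuous_snd)
  have hnum := (continuous_polymerRayDeriv_scaled inc w B).comp hg
  have hden := (continuous_polymerPartitionFunction_scaled inc w B).comp hg
  have hF := hnum.div hden fun p => hS p.1.1 p.1.2 _ (hmem p.2)
  have key := intervalIntegral.continuous_parametric_intervalIntegral_of_continuous'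
    (μ := MeasureTheory.volume)
    (f := fun (x : S) (u : ℝ) =>
      ((fun p : (P → ℝ) × ℝ => polymerRayDeriv inc (scaledActivity w p.1) B p.2) ∘
          fun q : S × ℝ => ((q.1 : P → ℝ), max 0 (min 1 q.2))) (x, u) /
        ((fun p : (P → ℝ) × ℝ =>
            polymerPartitionFunction inc (fun δ => (p.2 : ℂ) * scaledActivity w p.1 δ) B) ∘
          fun q : S × ℝ => ((q.1 : P → ℝ), max 0 (min 1 q.2))) (x, u)) hF 0 1
  rw [continuousOn_iff_continuous_restrict]
  refine key.congr fun x => ?_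
  rw [Set.restrict_apply, polymerLogZ_eq_integral_clamp (inc := inc) (scaledActivity w x.1) B]
  rfl

/-- Continuity of the truncated functional `Φ^T(C; c·w)` in the multipliers, on a set where the
partition functions of all sub-volumes of `C` along the rays do not vanish. [cite: KoteckyPreiss1986, §3 (continuity of Φ_t^T)] -/
theorem continuousOn_truncatedWeight_scaled (w : P → ℂ) (C : Finset P) {S : Set (P → ℝ)}
    (hS : ∀ c ∈ S, ∀ B ⊆ C, ∀ u ∈ Set.Icc (0 : ℝ) 1,
      polymerPartitionFunction inc (fun δ => (u : ℂ) * scaledActivity w c δ) B ≠ 0) :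
    ContinuousOn (fun c => truncatedWeight inc (scaledActivity w c) C) S := by
  unfold truncatedWeight
  refine continuousOn_finsetSum _ fun B hB => ?_
  exact continuousOn_const.mul
    (continuousOn_polymerLogZ_scaled w B fun c hc u hu => hS c hc B (Finset.mem_powerset.1 hB) u hu)

/-- In a KP volume `L`, multipliers in `[0, 1]` keep every sub-volume zero-free along the rays
(the activities only decrease in modulus). [cite: KoteckyPreiss1986, Theorem p. 492 (zero-freeness)] -/
theorem polymerPartitionFunction_scaled_ne_zero_of_kp [Std.Refl inc] [Std.Symm inc] {w : P → ℂ}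
    {a : P → ℝ} {L B : Finset P} (hKP : IsKPVolume inc w a L) (hB : B ⊆ L) {c : P → ℝ}
    (hc : ∀ δ, c δ ∈ Set.Icc (0 : ℝ) 1) {u : ℝ} (hu : u ∈ Set.Icc (0 : ℝ) 1) :
    polymerPartitionFunction inc (fun δ => (u : ℂ) * scaledActivity w c δ) B ≠ 0 := by
  have hKP' : IsKPVolume inc (fun δ => (u : ℂ) * scaledActivity w c δ) a L := fun γ hγ => by
    refine le_trans (Finset.sum_le_sum fun γ' _ => ?_) (hKP γ hγ)
    unfold kpTerm
    refine mul_le_mul_of_nonneg_right ?_ (Real.exp_nonneg _)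
    rw [norm_mul, Complex.norm_real, Real.norm_eq_abs, abs_of_nonneg hu.1]
    exact (mul_le_of_le_one_left (norm_nonneg _) hu.2).trans
      (norm_scaledActivity_le (hc γ').1 (hc γ').2)
  exact polymerPartitionFunction_ne_zero_of_kp hKP' hB

omit [DecidableEq P] in
/-- In a KP volume, scaled activities with multipliers in `[0,1]` again form a KP volume with the
same size function. [cite: KoteckyPreiss1986, (1)] -/
theorem isKPVolume_scaled [Std.Refl inc] [Std.Symm inc] {w : P → ℂ} {a : P → ℝ} {L : Finset P}
    (hKP : IsKPVolume inc w a L) {c : P → ℝ} (hc : ∀ δ, c δ ∈ Set.Icc (0 : ℝ) 1) :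
    IsKPVolume inc (scaledActivity w c) a L := fun γ hγ => by
  refine le_trans (Finset.sum_le_sum fun γ' _ => ?_) (hKP γ hγ)
  unfold kpTerm
  exact mul_le_mul_of_nonneg_right (norm_scaledActivity_le (hc γ').1 (hc γ').2) (Real.exp_nonneg _)

end Continuity

/-! ### The log-increment identity -/

/-- A complex number with `exp z = 1` and `‖z‖ < 2π` is zero. [folklore] -/
theorem eq_zero_of_exp_eq_one_of_norm_lt {z : ℂ} (hz : Complex.exp z = 1) (hn : ‖z‖ < 2 * Real.pi) :
    z = 0 := by
  obtain ⟨n, rfl⟩ := Complex.exp_eq_one_iff.1 hz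
  have hnorm : ‖(n : ℂ) * (2 * Real.pi * Complex.I)‖ = |(n : ℝ)| * (2 * Real.pi) := by
    rw [norm_mul, Complex.norm_intCast]
    congr 1
    rw [norm_mul, Complex.norm_I, mul_one, Complex.norm_mul, Complex.norm_ofNat,
      Complex.norm_real, Real.norm_eq_abs, abs_of_pos Real.pi_pos]
  rw [hnorm] at hn
  have h1 : |(n : ℝ)| < 1 := by
    by_contra h
    have h' : 1 ≤ |(n : ℝ)| := not_lt.1 h
    have := mul_le_mul_of_nonneg_right h' (by positivity : (0 : ℝ) ≤ 2 * Real.pi)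
    linarith
  have h2 : -1 < (n : ℝ) ∧ (n : ℝ) < 1 := abs_lt.1 h1
  have hn0 : n = 0 := by
    have h3 : (-1 : ℤ) < n ∧ n < 1 := by exact_mod_cast h2
    omega
  simp [hn0]

/-- **A continuous logarithm is differentiable, with the logarithmic derivative**: if `ψ` is
continuous at `t₀`, `exp (ψ t) = ζ t` near `t₀`, and `ζ` has derivative `ζ'` at `t₀` with
`ζ t₀ ≠ 0`, then `ψ` has derivative `ζ'/ζ t₀` at `t₀` (near `t₀`, `ψ` agrees with the holomorphic
branch `log (ζ t / ζ t₀) + ψ t₀`). [folklore] -/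
theorem hasDerivAt_of_exp_eq {ψ ζ : ℝ → ℂ} {ζ' : ℂ} {t₀ : ℝ} (hψ : ContinuousAt ψ t₀)
    (hexp : ∀ᶠ t in 𝓝 t₀, Complex.exp (ψ t) = ζ t) (hζ : HasDerivAt ζ ζ' t₀) (hne : ζ t₀ ≠ 0) :
    HasDerivAt ψ (ζ' / ζ t₀) t₀ := by
  -- the local holomorphic branch
  set Λf : ℝ → ℂ := fun t => Complex.log (ζ t / ζ t₀) + ψ t₀ with hΛf
  have hζc : ContinuousAt ζ t₀ := hζ.continuousAt
  have hquot : Tendsto (fun t => ζ t / ζ t₀) (𝓝 t₀) (𝓝 1) := by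
    have := hζc.div_const (ζ t₀)
    rwa [ContinuousAt, div_self hne] at this
  have hslit : ∀ᶠ t in 𝓝 t₀, ζ t / ζ t₀ ∈ Complex.slitPlane :=
    hquot.eventually (Complex.isOpen_slitPlane.mem_nhds (by simp))
  -- derivative of the branch at `t₀`
  have hΛd : HasDerivAt Λf (ζ' / ζ t₀) t₀ := by
    have h1 : HasDerivAt (fun t => ζ t / ζ t₀) (ζ' / ζ t₀) t₀ := hζ.div_const _
    have h2 : HasDerivAt (fun t => Complex.log (ζ t / ζ t₀)) ((ζ t₀ / ζ t₀)⁻¹ * (ζ' / ζ t₀)) t₀ := by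
      have hl := Complex.hasDerivAt_log (by rw [div_self hne]; simp : ζ t₀ / ζ t₀ ∈ Complex.slitPlane)
      exact hl.comp t₀ h1
    rw [div_self hne, inv_one, one_mul] at h2
    exact h2.add_const _
  -- `ψ = Λf` near `t₀`
  have hdiff : ∀ᶠ t in 𝓝 t₀, Complex.exp (ψ t - Λf t) = 1 := by
    filter_upwards [hexp, hslit] with t ht hs
    have hζt : ζ t ≠ 0 := fun h => by
      rw [h, zero_div] at hs
      exact Complex.slitPlane_ne_zero hs rfl
    rw [Complex.exp_sub, ht, hΛf]
    simp only
    rw [Complex.exp_add, Complex.exp_log (div_ne_zero hζt hne)]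
    have hψ₀ : Complex.exp (ψ t₀) = ζ t₀ := hexp.self_of_nhds
    rw [hψ₀]
    field_simp
  have hsmall : ∀ᶠ t in 𝓝 t₀, ‖ψ t - Λf t‖ < 2 * Real.pi := by
    have hc : ContinuousAt (fun t => ψ t - Λf t) t₀ := hψ.sub hΛd.continuousAt
    have h0 : ψ t₀ - Λf t₀ = 0 := by
      simp [hΛf, div_self hne]
    have := hc.norm
    rw [ContinuousAt, h0, norm_zero] at this
    exact this.eventually (gt_mem_nhds (by positivity))
  have heq : ∀ᶠ t in 𝓝 t₀, ψ t = Λf t := by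
    filter_upwards [hdiff, hsmall] with t h1 h2
    exact sub_eq_zero.1 (eq_zero_of_exp_eq_one_of_norm_lt h1 h2)
  exact hΛd.congr_of_eventuallyEq heq

/-- **The log-increment identity**: if `ψ` is continuous on `[a, b]`, `exp ∘ ψ = ζ` there, and
`ζ` has a continuous derivative `ζ'` and no zero on `[a, b]`, then `∫ₐᵇ ζ'/ζ = ψ(b) - ψ(a)`
(`ψ` is differentiable on `(a, b)` with derivative `ζ'/ζ` by `hasDerivAt_of_exp_eq`, and the
fundamental theorem of calculus applies). In [KP86, §3] this converts `Φ^T(C; Φ₁) - Φ^T(C; Φ₀)`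
into the integral over `t` of the derivative (13). [folklore] -/
theorem integral_div_eq_sub_of_exp_eq {ψ ζ ζ' : ℝ → ℂ} {a b : ℝ} (hab : a ≤ b)
    (hψ : ContinuousOn ψ (Set.Icc a b)) (hζ : ∀ t ∈ Set.Icc a b, HasDerivAt ζ (ζ' t) t)
    (hζ' : ContinuousOn ζ' (Set.Icc a b)) (hne : ∀ t ∈ Set.Icc a b, ζ t ≠ 0)
    (hexp : ∀ t ∈ Set.Icc a b, Complex.exp (ψ t) = ζ t) :
    ∫ t in a..b, ζ' t / ζ t = ψ b - ψ a := by
  have hζc : ContinuousOn ζ (Set.Icc a b) := fun t ht => (hζ t ht).continuousAt.continuousWithinAt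
  refine intervalIntegral.integral_eq_sub_of_hasDerivAt_of_le hab hψ (fun t ht => ?_) ?_
  · have hnhds : Set.Icc a b ∈ 𝓝 t := Icc_mem_nhds ht.1 ht.2
    have hψt : ContinuousAt ψ t := hψ.continuousAt hnhds
    have hexp' : ∀ᶠ s in 𝓝 t, Complex.exp (ψ s) = ζ s :=
      Filter.eventually_of_mem hnhds fun s hs => hexp s hs
    exact hasDerivAt_of_exp_eq hψt hexp' (hζ t (Set.Ioo_subset_Icc_self ht))
      (hne t (Set.Ioo_subset_Icc_self ht))
  · exact ((hζ'.div hζc hne).mono (by rw [Set.uIcc_of_le hab])).intervalIntegrable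

/-! ### Vanishing of the truncated functional ([KP86, (11)]) -/

/-- If the activity of `δ` vanishes, removing `δ` does not change the partition function.
[folklore] -/
theorem polymerPartitionFunction_eq_erase_of_eq_zero [Std.Symm inc] {w : P → ℂ} {δ : P}
    (hw : w δ = 0) (B : Finset P) :
    polymerPartitionFunction inc w B = polymerPartitionFunction inc w (B.erase δ) := by
  by_cases hδ : δ ∈ B
  · rw [polymerPartitionFunction_eq_erase_add inc_symm_of_symm w hδ, hw, zero_mul, add_zero]
  · rw [Finset.erase_eq_of_notMem hδ]

/-- If the activity of `δ` vanishes, removing `δ` does not change the ray derivative. [folklore] -/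
theorem polymerRayDeriv_eq_erase_of_eq_zero {w : P → ℂ} {δ : P} (hw : w δ = 0) (B : Finset P)
    (t : ℝ) : polymerRayDeriv inc w B t = polymerRayDeriv inc w (B.erase δ) t := by
  unfold polymerRayDeriv
  symm
  refine Finset.sum_subset (Finset.filter_subset_filter _
    (Finset.powerset_mono.2 (Finset.erase_subset δ B))) fun X hX hX' => ?_
  have hXB : X ⊆ B := Finset.mem_powerset.1 (Finset.mem_filter.1 hX).1
  have hδX : δ ∈ X := by
    by_contra h
    refine hX' (Finset.mem_filter.2 ⟨Finset.mem_powerset.2 fun γ hγ => ?_, (Finset.mem_filter.1 hX).2⟩)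
    exact Finset.mem_erase.2 ⟨fun h' => h (h' ▸ hγ), hXB hγ⟩
  rw [Finset.prod_eq_zero hδX hw, mul_zero]

/-- If the activity of `δ` vanishes, removing `δ` does not change the Kotecký–Preiss logarithm.
[folklore] -/
theorem polymerLogZ_eq_erase_of_eq_zero [Std.Symm inc] {w : P → ℂ} {δ : P} (hw : w δ = 0)
    (B : Finset P) : polymerLogZ inc w B = polymerLogZ inc w (B.erase δ) := by
  unfold polymerLogZ
  refine intervalIntegral.integral_congr fun t _ => ?_
  rw [polymerRayDeriv_eq_erase_of_eq_zero hw,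
    polymerPartitionFunction_eq_erase_of_eq_zero (w := fun γ => (t : ℂ) * w γ) (δ := δ)
      (by rw [hw, mul_zero]) B]

/-- **[KP86, (11)]**: if `C` touches `γ` and the activities of all polymers of `C` incompatible
with `γ` vanish, then `Φ^T(C) = 0` (for a `γ' ∈ C` with `γ' ι γ`, `log Z(B) = log Z(B ∖ γ')` for all
`B ⊆ C`, and the Möbius transform of a function of `B ∩ (C ∖ γ')` vanishes). [cite: KoteckyPreiss1986, §3 (11)] -/
theorem truncatedWeight_eq_zero_of_forall_inc_eq_zero [Std.Symm inc] {w : P → ℂ}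
    {C : Finset P} {γ : P} (hC : KPTouches inc C γ) (hw : ∀ δ ∈ C, inc δ γ → w δ = 0) :
    truncatedWeight inc w C = 0 := by
  obtain ⟨δ, hδC, hδγ⟩ := hC
  have hwδ : w δ = 0 := hw δ hδC hδγ
  unfold truncatedWeight
  have hrew : ∀ B ∈ C.powerset, (-1 : ℂ) ^ (C \ B).card * polymerLogZ inc w B =
      (-1 : ℂ) ^ (C \ B).card * polymerLogZ inc w (B ∩ C.erase δ) := by
    intro B hB
    have hBC : B ⊆ C := Finset.mem_powerset.1 hB
    have hint : B ∩ C.erase δ = B.erase δ := by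
      ext γ'
      simp only [Finset.mem_inter, Finset.mem_erase]
      constructor
      · rintro ⟨h1, h2, -⟩; exact ⟨h2, h1⟩
      · rintro ⟨h1, h2⟩; exact ⟨h2, h1, hBC h2⟩
    rw [hint, ← polymerLogZ_eq_erase_of_eq_zero hwδ]
  rw [Finset.sum_congr rfl hrew]
  refine sum_powerset_neg_one_pow_mul_apply_inter_eq_zero (polymerLogZ inc w)
    (Finset.erase_subset δ C) ?_
  exact ⟨δ, Finset.mem_sdiff.2 ⟨hδC, Finset.notMem_erase δ C⟩⟩

end Literature.Probability.LatticeModels
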